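import Literature.NumberTheory.Sieve.SieveFrameworkFundamentalLemma
import Literature.NumberTheory.Sieve.BrunPureSieve
import HarnessLib

/-!
# Two-range composite sieve weights: beta-sieve below `z₁`, Brun's pure sieve on `[z₁, z)`

Topic `Literature/NumberTheory/Sieve`.  Everything here is PROVED.  A sieve of level
`D₁ z^{2r+1}` for the sifting range `p < z`, obtained by COMPOSING Rosser's beta-sieve weights
`μ(d₁)χ^±(d₁)` (`β = 10`, level `D₁`, dimension `1`; the tree's
`Literature.NumberTheory.Sieve.BetaSieve`, Greaves §3.3) on the primes `< z₁` with Brun's pure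
sieve (truncated inclusion–exclusion to depth `2r`, resp. `2r+1`; the tree's
`Literature.NumberTheory.Sieve.BrunPureSieve`, Cojocaru–Murty §6.1) on the primes of `[z₁, z)`:
with `Λ^± = ∑ μχ^± 1_{d₁∣m}`, `B⁺ = ∑_{|S|≤2r} (−1)^{|S|} 1_{∏S∣m}`, `C = #{|S| = 2r+1, ∏S ∣ m}`,
the upper function is `U = Λ⁺B⁺` and the lower one `L = Λ⁻B⁺ − Λ⁺C` (a standard composition:
`Λ⁻ ≤ 1 ≤ Λ⁺`, `B⁺ − C ≤ 1 ≤ B⁺`, all applied to nonnegative indicators).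

Why: the beta-sieve Fundamental Lemma in the tree has quality `e^{−s}` only
(`BetaSieve.bdry_sum_le`), which is too weak when the sifting range `z` is as large as
`exp(log x / log log x)` and the level is `x^{ε}` (`s ≍ log log x`); splitting at
`z₁ = z^{1/C}` restores `s₁ = C s` for the beta-sieve part, while the primes of `[z₁, z)` — a range
of bounded logarithmic width, `∑_{z₁≤p<z} g(p) ≤ log(K log z/log z₁)` — are handled by Brun's pure
sieve, whose tail `e_{2r+1}(g) ≤ λ^{−(2r+1)} (K log z/log z₁)^{λ}` is super-exponentially small in `r`.
This is the device behind the `exp(−s log s)`-quality Fundamental Lemma quoted by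
Bombieri–Friedlander–Iwaniec (Acta Math. 156 (1986), Lemma 4 p. 211) in the proof of their
Theorem 5* (p. 238); it is used for exactly that purpose in
`Literature.NumberTheory.Sieve.BombieriFriedlanderIwaniecTheorem5StarFromTheorem5`.

## Main results (namespace `Literature.NumberTheory.Sieve.TwoRangeSieve`)

* `idx`, `modOf`, `wU`, `wL` — the index set (pairs `(d₁, S)`, `d₁ ∣ P(z₁)`, `S ⊆` primes of
  `[z₁,z)`), the modulus `d₁ ∏S`, and the weights; `abs_wU_le_one`, `abs_wL_le_one`.
* `sandwich` — `∑_i w⁻_i 1_{d(i)∣m} ≤ 1_{(m,P(z))=1} ≤ ∑_i w⁺_i 1_{d(i)∣m}` (`m ≠ 0`, `z₁ ≤ z`).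
* `modOf_lt` — nonzero weights have modulus `< D₁ z^{2r+1}` (`D₁ > 1`, `10 log z₁ ≤ log D₁`);
  `sum_abs_w_le` — `∑_i (|w⁺_i| + |w⁻_i|) ≤ 2(D₁+1)(#𝒫₂+1)^{2r+1}`.
* `abs_main_sub_le` — for multiplicative `g` of dimension `1` (constant `K`):
  `|∑_i w^±_i g(d(i)) − V₁V₂| ≤ V₁(η₁V₂ + (2+2η₁)T)`, `η₁ = 2K^{10}e^{10−log D₁/log z₁}`,
  `V₁ = ∏_{p<z₁}(1−g(p))`, `V₂ = ∏_{z₁≤p<z}(1−g(p))` (`vmid`), `T = e_{2r+1}(g)` (`tail`);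
  `vprod_eq_mul` — `V(z) = V₁V₂`; `vmid_tail_bounds` — `V₂⁻¹ ≤ K log z/log z₁` and the Rankin
  bound for `T`.

## References

* G. Greaves, *Sieves in Number Theory*, Springer 2001, §3.1.2 Lemma 1, §3.3.4 Thm 1. [Greaves2001]
* A. C. Cojocaru, M. R. Murty, *An Introduction to Sieve Methods and their Applications*, CUP
  2005, §6.1 (6.1)–(6.5), Lemma 6.1.1. [CojocaruMurty2005]
* E. Bombieri, J. B. Friedlander, H. Iwaniec, *Primes in arithmetic progressions to large moduli*,
  Acta Math. 156 (1986), 203–251, §2 Lemma 4 p. 211, §12 p. 238. [BombieriFriedlanderIwaniecActa1986]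
-/

open Finset Real
open scoped ArithmeticFunction.Moebius

namespace Literature.NumberTheory.Sieve

namespace TwoRangeSieve

/-! ### The two ranges of primes -/

/-- The primes of the upper range `z₁ ≤ p < z`. [folklore] -/
noncomputable def midPrimes (z₁ z : ℝ) : Finset ℕ :=
  (Nat.primesBelow ⌈z⌉₊).filter (fun p : ℕ => z₁ ≤ (p : ℝ))

/-- Membership in the upper range. [folklore] -/
theorem mem_midPrimes {z₁ z : ℝ} {p : ℕ} :
    p ∈ midPrimes z₁ z ↔ p.Prime ∧ z₁ ≤ (p : ℝ) ∧ (p : ℝ) < z := by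
  rw [midPrimes, Finset.mem_filter, Nat.mem_primesBelow, Nat.lt_ceil]
  tauto

/-- Elements of the upper range are prime. [folklore] -/
theorem prime_of_mem_midPrimes {z₁ z : ℝ} {p : ℕ} (hp : p ∈ midPrimes z₁ z) : p.Prime :=
  (mem_midPrimes.1 hp).1

/-- The primes `< z` split into the primes `< z₁` and the primes of `[z₁, z)`. [folklore] -/
theorem primesBelow_eq_union {z₁ z : ℝ} (h : z₁ ≤ z) :
    Nat.primesBelow ⌈z⌉₊ = Nat.primesBelow ⌈z₁⌉₊ ∪ midPrimes z₁ z := by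
  ext p
  rw [Finset.mem_union, mem_midPrimes, Nat.mem_primesBelow, Nat.mem_primesBelow, Nat.lt_ceil, Nat.lt_ceil]
  constructor
  · rintro ⟨hpz, hp⟩
    rcases lt_or_ge (p : ℝ) z₁ with h1 | h1
    · exact Or.inl ⟨h1, hp⟩
    · exact Or.inr ⟨hp, h1, hpz⟩
  · rintro (⟨h1, hp⟩ | ⟨hp, -, h2⟩)
    · exact ⟨lt_of_lt_of_le h1 h, hp⟩
    · exact ⟨h2, hp⟩

/-- The two ranges are disjoint. [folklore] -/
theorem disjoint_primesBelow_midPrimes (z₁ z : ℝ) :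
    Disjoint (Nat.primesBelow ⌈z₁⌉₊) (midPrimes z₁ z) := by
  rw [Finset.disjoint_left]
  intro p hp hq
  rw [Nat.mem_primesBelow, Nat.lt_ceil] at hp
  exact absurd (mem_midPrimes.1 hq).2.1 (not_le.2 hp.1)

/-- `(m, P(z)) = 1` iff `(m, P(z₁)) = 1` and no prime of `[z₁, z)` divides `m`. [folklore] -/
theorem coprime_primesProdBelow_iff_and {z₁ z : ℝ} (h : z₁ ≤ z) (m : ℕ) :
    m.Coprime (primesProdBelow z) ↔
      m.Coprime (primesProdBelow z₁) ∧ ∀ p ∈ midPrimes z₁ z, ¬ p ∣ m := by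
  rw [coprime_primesProdBelow_iff, coprime_primesProdBelow_iff, primesBelow_eq_union h]
  simp only [Finset.mem_union]
  constructor
  · intro H; exact ⟨fun q hq => H q (Or.inl hq), fun q hq => H q (Or.inr hq)⟩
  · rintro ⟨H1, H2⟩ q (hq | hq); exacts [H1 q hq, H2 q hq]

/-- A divisor of `P(z₁)` is coprime to a product of primes `≥ z₁`. [folklore] -/
theorem coprime_of_dvd_of_subset {z₁ z : ℝ} {d : ℕ} (hd : d ∣ primesProdBelow z₁) {S : Finset ℕ}
    (hS : S ⊆ midPrimes z₁ z) : d.Coprime (∏ p ∈ S, p) := by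
  rw [Nat.coprime_prod_right_iff]
  intro p hp
  have hp' := mem_midPrimes.1 (hS hp)
  rw [Nat.coprime_comm, hp'.1.coprime_iff_not_dvd]
  intro hpd
  have := (dvd_primesProdBelow_iff hp'.1 z₁).1 (hpd.trans hd)
  linarith [hp'.2.1]

/-! ### The weights -/

/-- The index set of the composite weights: pairs `(d₁, S)` with `d₁ ∣ P(z₁)` and `S` a set of
primes of `[z₁, z)`; the corresponding modulus is `d₁ · ∏ S`. [folklore] -/
noncomputable def idx (z₁ z : ℝ) : Finset (ℕ × Finset ℕ) :=
  (primesProdBelow z₁).divisors ×ˢ (midPrimes z₁ z).powerset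

/-- The modulus `d₁ · ∏_{p ∈ S} p` of an index. [folklore] -/
def modOf (i : ℕ × Finset ℕ) : ℕ := i.1 * ∏ p ∈ i.2, p

/-- **Upper composite weights**: Rosser's upper beta-sieve weight `μ(d₁)χ⁺(d₁)` (`β = 10`, level
`D₁`) on the primes `< z₁`, times Brun's pure-sieve weight `(−1)^{|S|} 1_{|S| ≤ 2r}` on `[z₁, z)`.
[folklore] -/
noncomputable def wU (D₁ : ℝ) (r : ℕ) (i : ℕ × Finset ℕ) : ℝ :=
  (μ i.1 : ℝ) * BetaSieve.ind 1 10 D₁ i.1 * (if i.2.card ≤ 2 * r then (-1 : ℝ) ^ i.2.card else 0)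

/-- **Lower composite weights**: `Λ⁻₁ B⁺ − Λ⁺₁ (B⁺ − B⁻)` expanded, i.e.
`μ(d₁)χ⁻(d₁) (−1)^{|S|} 1_{|S| ≤ 2r} − μ(d₁)χ⁺(d₁) 1_{|S| = 2r+1}`. [folklore] -/
noncomputable def wL (D₁ : ℝ) (r : ℕ) (i : ℕ × Finset ℕ) : ℝ :=
  (μ i.1 : ℝ) * BetaSieve.ind 0 10 D₁ i.1 * (if i.2.card ≤ 2 * r then (-1 : ℝ) ^ i.2.card else 0) -
    (μ i.1 : ℝ) * BetaSieve.ind 1 10 D₁ i.1 * (if i.2.card = 2 * r + 1 then 1 else 0)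

/-- `|μ(d) χ(d)| ≤ 1`. [folklore] -/
theorem abs_moebius_mul_ind_le (par : ℕ) (D₁ : ℝ) (d : ℕ) :
    |(μ d : ℝ) * BetaSieve.ind par 10 D₁ d| ≤ 1 := by
  rw [abs_mul]
  have h1 : |(μ d : ℝ)| ≤ 1 := by exact_mod_cast ArithmeticFunction.abs_moebius_le_one
  exact mul_le_one₀ h1 (abs_nonneg _) (BetaSieve.abs_ind_le_one d)

/-- `|w⁺| ≤ 1`. [folklore] -/
theorem abs_wU_le_one (D₁ : ℝ) (r : ℕ) (i : ℕ × Finset ℕ) : |wU D₁ r i| ≤ 1 := by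
  unfold wU
  rw [abs_mul]
  refine mul_le_one₀ (abs_moebius_mul_ind_le 1 D₁ i.1) (abs_nonneg _) ?_
  split_ifs <;> simp

/-- `|w⁻| ≤ 1` (the two terms have disjoint supports in `|S|`). [folklore] -/
theorem abs_wL_le_one (D₁ : ℝ) (r : ℕ) (i : ℕ × Finset ℕ) : |wL D₁ r i| ≤ 1 := by
  unfold wL
  by_cases h : i.2.card ≤ 2 * r
  · have h' : ¬ i.2.card = 2 * r + 1 := by omega
    rw [if_pos h, if_neg h', mul_zero, sub_zero, abs_mul]
    exact mul_le_one₀ (abs_moebius_mul_ind_le 0 D₁ i.1) (abs_nonneg _) (by simp)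
  · rw [if_neg h, mul_zero, zero_sub, abs_neg, abs_mul]
    refine mul_le_one₀ (abs_moebius_mul_ind_le 1 D₁ i.1) (abs_nonneg _) ?_
    split_ifs <;> simp

/-! ### The pointwise sieve functions -/

/-- `Λ^{par}(m) = ∑_{d ∣ P(z₁), d ∣ m} μ(d) χ^{par}(d)`. [folklore] -/
noncomputable def lam (par : ℕ) (z₁ D₁ : ℝ) (m : ℕ) : ℝ :=
  ∑ d ∈ (primesProdBelow z₁).divisors, (μ d : ℝ) * BetaSieve.ind par 10 D₁ d * (if d ∣ m then 1 else 0)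

/-- `B⁺(m) = ∑_{S ⊆ 𝒫₂, |S| ≤ 2r, ∏S ∣ m} (−1)^{|S|}`. [folklore] -/
noncomputable def bup (z₁ z : ℝ) (r : ℕ) (m : ℕ) : ℝ :=
  ∑ S ∈ (midPrimes z₁ z).powerset,
    (if S.card ≤ 2 * r then (-1 : ℝ) ^ S.card else 0) * (if (∏ p ∈ S, p) ∣ m then 1 else 0)

/-- `C(m) = #{S ⊆ 𝒫₂ : |S| = 2r+1, ∏S ∣ m} = binom(ω₂(m), 2r+1)`. [folklore] -/
noncomputable def codd (z₁ z : ℝ) (r : ℕ) (m : ℕ) : ℝ :=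
  ∑ S ∈ (midPrimes z₁ z).powerset,
    (if S.card = 2 * r + 1 then (1 : ℝ) else 0) * (if (∏ p ∈ S, p) ∣ m then 1 else 0)

/-- The sieve inequalities for `Λ±` (Rosser's weights on `P(z₁)`): for `m ≠ 0`,
`Λ⁻(m) ≤ 1_{(m, P(z₁)) = 1} ≤ Λ⁺(m)`. [cite: Greaves2001, §3.1.2 Lemma 1] -/
theorem lam_sandwich (z₁ D₁ : ℝ) {m : ℕ} (hm : m ≠ 0) :
    lam 0 z₁ D₁ m ≤ (if m.Coprime (primesProdBelow z₁) then 1 else 0) ∧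
      (if m.Coprime (primesProdBelow z₁) then (1 : ℝ) else 0) ≤ lam 1 z₁ D₁ m := by
  set P₁ := primesProdBelow z₁ with hP₁
  have hP0 : P₁ ≠ 0 := primesProdBelow_ne_zero z₁
  have hnsq : Squarefree (Nat.gcd m P₁) :=
    (squarefree_primesProdBelow z₁).squarefree_of_dvd (Nat.gcd_dvd_right _ _)
  have hset : P₁.divisors.filter (fun d : ℕ => d ∣ m) = (Nat.gcd m P₁).divisors := by
    ext d
    simp only [Finset.mem_filter, Nat.mem_divisors, Nat.dvd_gcd_iff, ne_eq, Nat.gcd_eq_zero_iff, not_and]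
    constructor
    · rintro ⟨⟨hdP, -⟩, hdm⟩; exact ⟨⟨hdm, hdP⟩, fun h => absurd h hm⟩
    · rintro ⟨⟨hdm, hdP⟩, -⟩; exact ⟨⟨hdP, hP0⟩, hdm⟩
  have hkey : ∀ par : ℕ, lam par z₁ D₁ m =
      ∑ d ∈ (Nat.gcd m P₁).divisors, (μ d : ℝ) * BetaSieve.ind par 10 D₁ d := by
    intro par
    unfold lam
    rw [← hset, Finset.sum_filter]
    exact Finset.sum_congr rfl fun d _ => by split_ifs <;> simp
  have hind : (if m.Coprime P₁ then (1 : ℝ) else 0) = (if Nat.gcd m P₁ = 1 then (1 : ℝ) else 0) := by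
    rfl
  rw [hkey 0, hkey 1, hind]
  exact ⟨BetaSieve.lower_sieve hnsq, BetaSieve.upper_sieve hnsq⟩

/-- `Λ⁺ ≥ 0`. [folklore] -/
theorem lam_one_nonneg (z₁ D₁ : ℝ) {m : ℕ} (hm : m ≠ 0) : 0 ≤ lam 1 z₁ D₁ m :=
  le_trans (by positivity) (lam_sandwich z₁ D₁ hm).2

/-- `Λ⁻ ≤ Λ⁺`. [folklore] -/
theorem lam_zero_le_lam_one (z₁ D₁ : ℝ) {m : ℕ} (hm : m ≠ 0) : lam 0 z₁ D₁ m ≤ lam 1 z₁ D₁ m :=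
  (lam_sandwich z₁ D₁ hm).1.trans (lam_sandwich z₁ D₁ hm).2

/-- The set of primes of `[z₁, z)` dividing `m`. [folklore] -/
noncomputable def divSet (z₁ z : ℝ) (m : ℕ) : Finset ℕ := (midPrimes z₁ z).filter (fun p : ℕ => p ∣ m)

/-- `∏S ∣ m` iff `S` consists of prime divisors of `m`. [folklore] -/
theorem prod_dvd_iff_subset_divSet {z₁ z : ℝ} {m : ℕ} {S : Finset ℕ} (hS : S ⊆ midPrimes z₁ z) :
    (∏ p ∈ S, p) ∣ m ↔ S ⊆ divSet z₁ z m := by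
  rw [← BrunPureSieve.forall_prime_dvd_iff_prod_dvd (fun p hp => prime_of_mem_midPrimes (hS hp))]
  constructor
  · intro H p hp; exact Finset.mem_filter.2 ⟨hS hp, H p hp⟩
  · intro H p hp; exact (Finset.mem_filter.1 (H hp)).2

/-- Sums of `f(|S|) 1_{∏S ∣ m}` over `S ⊆ 𝒫₂` are binomial sums in `t = ω₂(m)`. [folklore] -/
theorem sum_powerset_prod_dvd_eq (z₁ z : ℝ) (m : ℕ) (f : ℕ → ℝ) :
    ∑ S ∈ (midPrimes z₁ z).powerset, f S.card * (if (∏ p ∈ S, p) ∣ m then 1 else 0) =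
      ∑ j ∈ Finset.range ((divSet z₁ z m).card + 1), ((divSet z₁ z m).card.choose j : ℝ) * f j := by
  have hsub : divSet z₁ z m ⊆ midPrimes z₁ z := Finset.filter_subset _ _
  calc ∑ S ∈ (midPrimes z₁ z).powerset, f S.card * (if (∏ p ∈ S, p) ∣ m then 1 else 0)
      = ∑ S ∈ (midPrimes z₁ z).powerset, (if S ⊆ divSet z₁ z m then f S.card else 0) := by
        refine Finset.sum_congr rfl fun S hS => ?_
        rw [Finset.mem_powerset] at hS
        by_cases h : S ⊆ divSet z₁ z m
        · rw [if_pos h, if_pos ((prod_dvd_iff_subset_divSet hS).2 h), mul_one]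
        · rw [if_neg h, if_neg (fun h' => h ((prod_dvd_iff_subset_divSet hS).1 h')), mul_zero]
    _ = ∑ S ∈ (divSet z₁ z m).powerset, f S.card := by
        rw [← Finset.sum_filter]
        refine Finset.sum_congr ?_ fun _ _ => rfl
        ext S
        rw [Finset.mem_filter, Finset.mem_powerset, Finset.mem_powerset]
        exact ⟨fun h => h.2, fun h => ⟨h.trans hsub, h⟩⟩
    _ = _ := by
        rw [Finset.sum_powerset_apply_card]
        exact Finset.sum_congr rfl fun j _ => by rw [nsmul_eq_mul]

/-- Truncated binomial sums: `∑_{j ≤ t} binom(t,j) 1_{j ≤ K} g(j) = ∑_{j ≤ K} g(j) binom(t,j)`. [folklore] -/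
theorem sum_range_choose_trunc (t K : ℕ) (g : ℕ → ℝ) :
    ∑ j ∈ Finset.range (t + 1), (t.choose j : ℝ) * (if j ≤ K then g j else 0) =
      ∑ j ∈ Finset.range (K + 1), g j * (t.choose j : ℝ) := by
  have hL : ∑ j ∈ Finset.range (t + 1), (t.choose j : ℝ) * (if j ≤ K then g j else 0) =
      ∑ j ∈ Finset.range (t + K + 1), (if j ≤ K then g j * (t.choose j : ℝ) else 0) := by
    refine (Finset.sum_congr rfl fun j _ => ?_).trans
      (Finset.sum_subset (Finset.range_subset_range.2 (by omega)) fun j hj hj' => ?_)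
    · split_ifs <;> ring
    · rw [Finset.mem_range] at hj hj'
      rw [Nat.choose_eq_zero_of_lt (by omega)]; simp
  have hR : ∑ j ∈ Finset.range (K + 1), g j * (t.choose j : ℝ) =
      ∑ j ∈ Finset.range (t + K + 1), (if j ≤ K then g j * (t.choose j : ℝ) else 0) := by
    refine (Finset.sum_congr rfl fun j hj => ?_).trans
      (Finset.sum_subset (Finset.range_subset_range.2 (by omega)) fun j hj hj' => ?_)
    · rw [Finset.mem_range] at hj; rw [if_pos (by omega)]
    · rw [Finset.mem_range] at hj hj'
      rw [if_neg (by omega)]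
  rw [hL, hR]

/-- `B⁺(m) = ∑_{j ≤ 2r} (−1)^j binom(t, j)`, `t = ω₂(m)`. [folklore] -/
theorem bup_eq (z₁ z : ℝ) (r : ℕ) (m : ℕ) :
    bup z₁ z r m = ∑ j ∈ Finset.range (2 * r + 1),
      (-1 : ℝ) ^ j * ((divSet z₁ z m).card.choose j : ℝ) := by
  unfold bup
  have h := sum_powerset_prod_dvd_eq z₁ z m (fun n => if n ≤ 2 * r then (-1 : ℝ) ^ n else 0)
  rw [h, sum_range_choose_trunc]

/-- `C(m) = binom(t, 2r+1)`, `t = ω₂(m)`. [folklore] -/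
theorem codd_eq (z₁ z : ℝ) (r : ℕ) (m : ℕ) :
    codd z₁ z r m = ((divSet z₁ z m).card.choose (2 * r + 1) : ℝ) := by
  unfold codd
  have h := sum_powerset_prod_dvd_eq z₁ z m (fun n => if n = 2 * r + 1 then (1 : ℝ) else 0)
  rw [h]
  set t := (divSet z₁ z m).card
  rw [Finset.sum_congr rfl (g := fun j => if j = 2 * r + 1 then (t.choose j : ℝ) else 0)
    (fun j _ => by split_ifs <;> simp), Finset.sum_ite_eq']
  split_ifs with h
  · rfl
  · rw [Finset.mem_range, not_lt] at h
    rw [Nat.choose_eq_zero_of_lt (by omega), Nat.cast_zero]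

/-- `B⁺(m) ≥ 1_{no prime of [z₁,z) divides m} ≥ 0` (Bonferroni, even truncation).
[cite: CojocaruMurty2005, §6.1 (6.3)] -/
theorem indicator_le_bup (z₁ z : ℝ) (r : ℕ) (m : ℕ) :
    (if ∀ p ∈ midPrimes z₁ z, ¬ p ∣ m then (1 : ℝ) else 0) ≤ bup z₁ z r m := by
  rw [bup_eq]
  have h := BrunPureSieve.indicator_le_alternatingSum_choose (r := 2 * r) ⟨r, by ring⟩
    (divSet z₁ z m).card
  refine le_trans (le_of_eq ?_) h
  have hiff : (∀ p ∈ midPrimes z₁ z, ¬ p ∣ m) ↔ (divSet z₁ z m).card = 0 := by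
    rw [Finset.card_eq_zero, divSet, Finset.filter_eq_empty_iff]
  by_cases hc : ∀ p ∈ midPrimes z₁ z, ¬ p ∣ m
  · rw [if_pos hc, if_pos (hiff.1 hc)]
  · rw [if_neg hc, if_neg (fun h' => hc (hiff.2 h'))]

/-- `B⁺ ≥ 0`. [folklore] -/
theorem bup_nonneg (z₁ z : ℝ) (r : ℕ) (m : ℕ) : 0 ≤ bup z₁ z r m :=
  le_trans (by positivity) (indicator_le_bup z₁ z r m)

/-- `B⁻(m) = B⁺(m) − C(m) ≤ 1_{no prime of [z₁,z) divides m}` (Bonferroni, odd truncation).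
[cite: CojocaruMurty2005, §6.1 (6.1)–(6.3)] -/
theorem bup_sub_codd_le (z₁ z : ℝ) (r : ℕ) (m : ℕ) :
    bup z₁ z r m - codd z₁ z r m ≤ (if ∀ p ∈ midPrimes z₁ z, ¬ p ∣ m then (1 : ℝ) else 0) := by
  rw [bup_eq, codd_eq]
  set t := (divSet z₁ z m).card with ht
  have h := BrunPureSieve.alternatingSum_choose_eq t (2 * r + 1)
  rw [Finset.sum_range_succ] at h
  have hodd : (-1 : ℝ) ^ (2 * r + 1) = -1 := by
    rw [pow_succ, pow_mul]; norm_num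
  rw [hodd] at h
  have hiff : (∀ p ∈ midPrimes z₁ z, ¬ p ∣ m) ↔ t = 0 := by
    rw [ht, Finset.card_eq_zero, divSet, Finset.filter_eq_empty_iff]
  have h' : (∑ j ∈ Finset.range (2 * r + 1), (-1 : ℝ) ^ j * (t.choose j : ℝ)) - (t.choose (2 * r + 1) : ℝ) =
      if t = 0 then 1 else -1 * ((t - 1).choose (2 * r + 1) : ℝ) := by
    rw [← h]; ring
  rw [h']
  by_cases h0 : t = 0
  · rw [if_pos h0, if_pos (hiff.2 h0)]
  · rw [if_neg h0, if_neg (fun hc => h0 (hiff.1 hc))]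
    have : (0 : ℝ) ≤ ((t - 1).choose (2 * r + 1) : ℝ) := Nat.cast_nonneg _
    linarith

/-- `C ≥ 0`. [folklore] -/
theorem codd_nonneg (z₁ z : ℝ) (r : ℕ) (m : ℕ) : 0 ≤ codd z₁ z r m := by
  rw [codd_eq]; exact Nat.cast_nonneg _

/-! ### The composite weights as pointwise functions -/

/-- `U(m) = ∑_i w⁺_i 1_{d(i) ∣ m} = Λ⁺(m) B⁺(m)`. [folklore] -/
theorem sum_wU_eq (z₁ z D₁ : ℝ) (r : ℕ) (m : ℕ) :
    ∑ i ∈ idx z₁ z, wU D₁ r i * (if modOf i ∣ m then 1 else 0) = lam 1 z₁ D₁ m * bup z₁ z r m := by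
  unfold idx lam bup
  rw [Finset.sum_product, Finset.sum_mul_sum]
  refine Finset.sum_congr rfl fun d hd => Finset.sum_congr rfl fun S hS => ?_
  rw [Nat.mem_divisors] at hd
  rw [Finset.mem_powerset] at hS
  have hcop := coprime_of_dvd_of_subset hd.1 hS
  have hdvd : (modOf (d, S) ∣ m) ↔ (d ∣ m ∧ (∏ p ∈ S, p) ∣ m) := by
    unfold modOf
    exact ⟨fun h => ⟨dvd_of_mul_right_dvd h, dvd_of_mul_left_dvd h⟩,
      fun h => hcop.mul_dvd_of_dvd_of_dvd h.1 h.2⟩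
  unfold wU
  by_cases h1 : d ∣ m <;> by_cases h2 : (∏ p ∈ S, p) ∣ m <;>
    simp only [hdvd, h1, h2, and_self, and_true, and_false, if_true, if_false] <;> ring

/-- `L(m) = ∑_i w⁻_i 1_{d(i) ∣ m} = Λ⁻(m) B⁺(m) − Λ⁺(m) C(m)`. [folklore] -/
theorem sum_wL_eq (z₁ z D₁ : ℝ) (r : ℕ) (m : ℕ) :
    ∑ i ∈ idx z₁ z, wL D₁ r i * (if modOf i ∣ m then 1 else 0) =
      lam 0 z₁ D₁ m * bup z₁ z r m - lam 1 z₁ D₁ m * codd z₁ z r m := by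
  unfold idx lam bup codd
  rw [Finset.sum_product, Finset.sum_mul_sum, Finset.sum_mul_sum, ← Finset.sum_sub_distrib]
  refine Finset.sum_congr rfl fun d hd => ?_
  rw [← Finset.sum_sub_distrib]
  refine Finset.sum_congr rfl fun S hS => ?_
  rw [Nat.mem_divisors] at hd
  rw [Finset.mem_powerset] at hS
  have hcop := coprime_of_dvd_of_subset hd.1 hS
  have hdvd : (modOf (d, S) ∣ m) ↔ (d ∣ m ∧ (∏ p ∈ S, p) ∣ m) := by
    unfold modOf
    exact ⟨fun h => ⟨dvd_of_mul_right_dvd h, dvd_of_mul_left_dvd h⟩,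
      fun h => hcop.mul_dvd_of_dvd_of_dvd h.1 h.2⟩
  unfold wL
  by_cases h1 : d ∣ m <;> by_cases h2 : (∏ p ∈ S, p) ∣ m <;>
    simp only [hdvd, h1, h2, and_self, and_true, and_false, if_true, if_false] <;> ring

/-- **The composite sieve inequalities**: for `z₁ ≤ z` and `m ≠ 0`,
`∑_i w⁻_i 1_{d(i) ∣ m} ≤ 1_{(m, P(z)) = 1} ≤ ∑_i w⁺_i 1_{d(i) ∣ m}`. [folklore] -/
theorem sandwich {z₁ z : ℝ} (hz : z₁ ≤ z) (D₁ : ℝ) (r : ℕ) {m : ℕ} (hm : m ≠ 0) :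
    ∑ i ∈ idx z₁ z, wL D₁ r i * (if modOf i ∣ m then 1 else 0) ≤
        (if m.Coprime (primesProdBelow z) then (1 : ℝ) else 0) ∧
      (if m.Coprime (primesProdBelow z) then (1 : ℝ) else 0) ≤
        ∑ i ∈ idx z₁ z, wU D₁ r i * (if modOf i ∣ m then 1 else 0) := by
  rw [sum_wU_eq, sum_wL_eq]
  obtain ⟨hL1, hU1⟩ := lam_sandwich z₁ D₁ hm
  have hB := indicator_le_bup z₁ z r m
  have hBC := bup_sub_codd_le z₁ z r m
  have hB0 := bup_nonneg z₁ z r m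
  have hC0 := codd_nonneg z₁ z r m
  have hU0 := lam_one_nonneg z₁ D₁ hm
  -- the target indicator is the product of the two indicators
  have hprod : (if m.Coprime (primesProdBelow z) then (1 : ℝ) else 0) =
      (if m.Coprime (primesProdBelow z₁) then (1 : ℝ) else 0) *
        (if ∀ p ∈ midPrimes z₁ z, ¬ p ∣ m then (1 : ℝ) else 0) := by
    rw [ite_zero_mul_ite_zero, one_mul]
    congr 1
    exact propext (coprime_primesProdBelow_iff_and hz m)
  rw [hprod]
  set a : ℝ := if m.Coprime (primesProdBelow z₁) then 1 else 0 with ha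
  set b : ℝ := if ∀ p ∈ midPrimes z₁ z, ¬ p ∣ m then 1 else 0 with hb
  have ha0 : 0 ≤ a := by rw [ha]; positivity
  have hb0 : 0 ≤ b := by rw [hb]; positivity
  constructor
  · -- lower: case on `b`
    by_cases hc : ∀ p ∈ midPrimes z₁ z, ¬ p ∣ m
    · -- `t = 0`: `B⁺ = 1`, `C = 0`
      have ht : (divSet z₁ z m).card = 0 := by
        rw [Finset.card_eq_zero, divSet, Finset.filter_eq_empty_iff]; exact hc
      have hB1 : bup z₁ z r m = 1 := by
        rw [bup_eq, ht, Finset.sum_range_succ']; simp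
      have hC1 : codd z₁ z r m = 0 := by
        rw [codd_eq, ht, Nat.choose_eq_zero_of_lt (by omega), Nat.cast_zero]
      have hb1 : b = 1 := by rw [hb, if_pos hc]
      rw [hB1, hC1, hb1]; linarith
    · have hb1 : b = 0 := by rw [hb, if_neg hc]
      rw [hb1] at hBC ⊢
      rw [mul_zero]
      -- `Λ⁻ B⁺ − Λ⁺ C ≤ Λ⁺ B⁺ − Λ⁺ C = Λ⁺ (B⁺ − C) ≤ 0`
      have h1 : lam 0 z₁ D₁ m * bup z₁ z r m ≤ lam 1 z₁ D₁ m * bup z₁ z r m :=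
        mul_le_mul_of_nonneg_right (hL1.trans hU1) hB0
      have h2 : lam 1 z₁ D₁ m * (bup z₁ z r m - codd z₁ z r m) ≤ 0 :=
        mul_nonpos_of_nonneg_of_nonpos hU0 hBC
      nlinarith
  · calc a * b ≤ lam 1 z₁ D₁ m * b := mul_le_mul_of_nonneg_right hU1 hb0
      _ ≤ lam 1 z₁ D₁ m * bup z₁ z r m := mul_le_mul_of_nonneg_left hB hU0

/-! ### Level and size of the support -/

/-- A nonzero weight forces `χ(d₁) = 1` for some truncation set and `|S| ≤ 2r + 1`. [folklore] -/
theorem pred_of_ne_zero {D₁ : ℝ} {r : ℕ} {i : ℕ × Finset ℕ} (hw : wU D₁ r i ≠ 0 ∨ wL D₁ r i ≠ 0) :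
    (BetaSieve.pred 1 10 D₁ i.1 ∨ BetaSieve.pred 0 10 D₁ i.1) ∧ i.2.card ≤ 2 * r + 1 := by
  have key : ∀ par : ℕ, BetaSieve.ind par 10 D₁ i.1 ≠ 0 → BetaSieve.pred par 10 D₁ i.1 := by
    intro par h
    by_contra hp
    exact h (BetaSieve.ind_of_not_pred hp)
  rcases hw with h | h
  · unfold wU at h
    have h1 : BetaSieve.ind 1 10 D₁ i.1 ≠ 0 := by
      intro h0; rw [h0] at h; simp at h
    have h2 : i.2.card ≤ 2 * r := by
      by_contra hc; rw [if_neg hc] at h; simp at h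
    exact ⟨Or.inl (key 1 h1), by omega⟩
  · unfold wL at h
    by_cases hc : i.2.card ≤ 2 * r
    · have hc' : ¬ i.2.card = 2 * r + 1 := by omega
      rw [if_pos hc, if_neg hc'] at h
      have h1 : BetaSieve.ind 0 10 D₁ i.1 ≠ 0 := by
        intro h0; rw [h0] at h; simp at h
      exact ⟨Or.inr (key 0 h1), by omega⟩
    · rw [if_neg hc] at h
      have hc' : i.2.card = 2 * r + 1 := by
        by_contra hc'; rw [if_neg hc'] at h; simp at h
      have h1 : BetaSieve.ind 1 10 D₁ i.1 ≠ 0 := by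
        intro h0; rw [h0] at h; simp at h
      exact ⟨Or.inl (key 1 h1), by omega⟩

/-- **Level of the composite weights**: if `D₁ > 1`, `10 log z₁ ≤ log D₁` and `z ≥ 1`, every index
with a nonzero weight has modulus `< D₁ z^{2r+1}`. [folklore] -/
theorem modOf_lt {z₁ z D₁ : ℝ} {r : ℕ} (hD1 : 1 < D₁) (hzD : 10 * Real.log z₁ ≤ Real.log D₁)
    (hz : 1 ≤ z) {i : ℕ × Finset ℕ} (hi : i ∈ idx z₁ z) (hw : wU D₁ r i ≠ 0 ∨ wL D₁ r i ≠ 0) :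
    (modOf i : ℝ) < D₁ * z ^ (2 * r + 1) := by
  obtain ⟨hpred, hcard⟩ := pred_of_ne_zero hw
  rw [idx, Finset.mem_product, Nat.mem_divisors, Finset.mem_powerset] at hi
  obtain ⟨⟨hd, -⟩, hS⟩ := hi
  have hsq : Squarefree i.1 := (squarefree_primesProdBelow z₁).squarefree_of_dvd hd
  have hpz : ∀ p ∈ i.1.primeFactors, (p : ℝ) < z₁ := fun p hp =>
    (dvd_primesProdBelow_iff (Nat.prime_of_mem_primeFactors hp) z₁).1
      ((Nat.dvd_of_mem_primeFactors hp).trans hd)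
  have h1 : (i.1 : ℝ) < D₁ := by
    rcases hpred with h | h
    · exact BetaSieve.lt_level_of_pred (by norm_num) hD1 hzD hsq hpz h
    · exact BetaSieve.lt_level_of_pred (by norm_num) hD1 hzD hsq hpz h
  have h2 : ((∏ p ∈ i.2, p : ℕ) : ℝ) ≤ z ^ (2 * r + 1) := by
    push_cast
    calc ∏ p ∈ i.2, (p : ℝ) ≤ ∏ _p ∈ i.2, z := by
          refine Finset.prod_le_prod (fun p _ => Nat.cast_nonneg p) fun p hp => ?_
          exact (mem_midPrimes.1 (hS hp)).2.2.le
      _ = z ^ i.2.card := Finset.prod_const z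
      _ ≤ z ^ (2 * r + 1) := pow_le_pow_right₀ hz hcard
  have h3 : (0 : ℝ) < ((∏ p ∈ i.2, p : ℕ) : ℝ) := by
    have : 0 < ∏ p ∈ i.2, p := Finset.prod_pos fun p hp => (prime_of_mem_midPrimes (hS hp)).pos
    exact_mod_cast this
  unfold modOf
  rw [Nat.cast_mul]
  calc (i.1 : ℝ) * ((∏ p ∈ i.2, p : ℕ) : ℝ) < D₁ * ((∏ p ∈ i.2, p : ℕ) : ℝ) :=
        mul_lt_mul_of_pos_right h1 h3
    _ ≤ D₁ * z ^ (2 * r + 1) := mul_le_mul_of_nonneg_left h2 (by linarith)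

/-- **Size of the support**: `∑_i (|w⁺_i| + |w⁻_i|) ≤ 2 (D₁ + 1) (#𝒫₂ + 1)^{2r+1}` (at most `D₁ + 1`
admissible `d₁ < D₁` and `∑_{j ≤ 2r+1} binom(#𝒫₂, j) ≤ (#𝒫₂+1)^{2r+1}` admissible `S`). [folklore] -/
theorem sum_abs_w_le {z₁ z D₁ : ℝ} {r : ℕ} (hD1 : 1 < D₁) (hzD : 10 * Real.log z₁ ≤ Real.log D₁) :
    ∑ i ∈ idx z₁ z, (|wU D₁ r i| + |wL D₁ r i|) ≤
      2 * (D₁ + 1) * ((midPrimes z₁ z).card + 1 : ℝ) ^ (2 * r + 1) := by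
  set A : Finset ℕ := (primesProdBelow z₁).divisors.filter (fun d : ℕ => (d : ℝ) < D₁) with hA
  set B : Finset (Finset ℕ) := (midPrimes z₁ z).powerset.filter (fun S => S.card ≤ 2 * r + 1) with hB
  have hsupp : ∀ i ∈ idx z₁ z, i ∉ A ×ˢ B → |wU D₁ r i| + |wL D₁ r i| = 0 := by
    intro i hi hnot
    by_contra hne
    have hw : wU D₁ r i ≠ 0 ∨ wL D₁ r i ≠ 0 := by
      by_contra h
      rw [not_or, not_ne_iff, not_ne_iff] at h
      exact hne (by rw [h.1, h.2]; simp)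
    obtain ⟨hpred, hcard⟩ := pred_of_ne_zero hw
    apply hnot
    rw [idx, Finset.mem_product, Nat.mem_divisors, Finset.mem_powerset] at hi
    obtain ⟨⟨hd, hP0⟩, hS⟩ := hi
    have hsq : Squarefree i.1 := (squarefree_primesProdBelow z₁).squarefree_of_dvd hd
    have hpz : ∀ p ∈ i.1.primeFactors, (p : ℝ) < z₁ := fun p hp =>
      (dvd_primesProdBelow_iff (Nat.prime_of_mem_primeFactors hp) z₁).1
        ((Nat.dvd_of_mem_primeFactors hp).trans hd)
    have h1 : (i.1 : ℝ) < D₁ := by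
      rcases hpred with h | h
      · exact BetaSieve.lt_level_of_pred (by norm_num) hD1 hzD hsq hpz h
      · exact BetaSieve.lt_level_of_pred (by norm_num) hD1 hzD hsq hpz h
    rw [Finset.mem_product, hA, hB, Finset.mem_filter, Finset.mem_filter, Nat.mem_divisors,
      Finset.mem_powerset]
    exact ⟨⟨⟨hd, hP0⟩, h1⟩, hS, hcard⟩
  have hAB : A ×ˢ B ⊆ idx z₁ z := by
    rw [idx]
    exact Finset.product_subset_product (Finset.filter_subset _ _) (Finset.filter_subset _ _)
  rw [← Finset.sum_subset hAB (fun i hi hnot => hsupp i hi hnot)]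
  -- on `A × B` each term is `≤ 2`
  have hcardA : (A.card : ℝ) ≤ D₁ + 1 := by
    have hsub : A ⊆ Finset.range ⌈D₁⌉₊ := by
      intro d hd
      rw [hA, Finset.mem_filter] at hd
      rw [Finset.mem_range, Nat.lt_ceil]
      exact hd.2
    calc (A.card : ℝ) ≤ ((Finset.range ⌈D₁⌉₊).card : ℝ) := by exact_mod_cast Finset.card_le_card hsub
      _ = ⌈D₁⌉₊ := by rw [Finset.card_range]
      _ ≤ D₁ + 1 := (Nat.ceil_lt_add_one (by linarith)).le
  have hcardB : (B.card : ℝ) ≤ ((midPrimes z₁ z).card + 1 : ℝ) ^ (2 * r + 1) := by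
    have hBeq : B = (Finset.range (2 * r + 1 + 1)).biUnion (fun j => Finset.powersetCard j (midPrimes z₁ z)) := by
      ext S
      rw [hB, Finset.mem_filter, Finset.mem_powerset, Finset.mem_biUnion]
      constructor
      · rintro ⟨h1, h2⟩
        exact ⟨S.card, Finset.mem_range.2 (by omega), Finset.mem_powersetCard.2 ⟨h1, rfl⟩⟩
      · rintro ⟨j, hj, hS⟩
        rw [Finset.mem_powersetCard] at hS
        rw [Finset.mem_range] at hj
        exact ⟨hS.1, by omega⟩
    rw [hBeq]
    calc (((Finset.range (2 * r + 1 + 1)).biUnion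
          (fun j => Finset.powersetCard j (midPrimes z₁ z))).card : ℝ)
        ≤ ∑ j ∈ Finset.range (2 * r + 1 + 1), ((Finset.powersetCard j (midPrimes z₁ z)).card : ℝ) := by
          exact_mod_cast Finset.card_biUnion_le
      _ = ∑ j ∈ Finset.range (2 * r + 1 + 1), ((midPrimes z₁ z).card.choose j : ℝ) := by
          simp_rw [Finset.card_powersetCard]
      _ ≤ ((midPrimes z₁ z).card + 1 : ℝ) ^ (2 * r + 1) := by
          exact_mod_cast BrunPureSieve.sum_range_choose_le_pow _ _
  calc ∑ i ∈ A ×ˢ B, (|wU D₁ r i| + |wL D₁ r i|) ≤ ∑ _i ∈ A ×ˢ B, (2 : ℝ) :=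
        Finset.sum_le_sum fun i _ => by linarith [abs_wU_le_one D₁ r i, abs_wL_le_one D₁ r i]
    _ = 2 * (A.card * B.card : ℝ) := by
        rw [Finset.sum_const, nsmul_eq_mul, Finset.card_product]; push_cast; ring
    _ ≤ 2 * ((D₁ + 1) * ((midPrimes z₁ z).card + 1 : ℝ) ^ (2 * r + 1)) := by
        refine mul_le_mul_of_nonneg_left (mul_le_mul hcardA hcardB (Nat.cast_nonneg _) (by linarith))
          (by norm_num)
    _ = _ := by ring

/-! ### The main terms -/

section MainTerm

variable {g : ArithmeticFunction ℝ} {K : ℝ}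

/-- `V₂ = ∏_{z₁ ≤ p < z} (1 − g(p))`. [folklore] -/
noncomputable def vmid (g : ArithmeticFunction ℝ) (z₁ z : ℝ) : ℝ := ∏ p ∈ midPrimes z₁ z, (1 - g p)

/-- `T = e_{2r+1}(g) = ∑_{S ⊆ 𝒫₂, |S| = 2r+1} ∏_{p ∈ S} g(p)`, the Bonferroni tail. [folklore] -/
noncomputable def tail (g : ArithmeticFunction ℝ) (z₁ z : ℝ) (r : ℕ) : ℝ :=
  ∑ S ∈ Finset.powersetCard (2 * r + 1) (midPrimes z₁ z), ∏ p ∈ S, g p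

/-- The beta-sieve main terms `M^{par} = ∑_{d ∣ P(z₁)} μ(d) χ^{par}(d) g(d)`. [folklore] -/
noncomputable def mbeta (g : ArithmeticFunction ℝ) (par : ℕ) (z₁ D₁ : ℝ) : ℝ :=
  ∑ d ∈ (primesProdBelow z₁).divisors, (μ d : ℝ) * BetaSieve.ind par 10 D₁ d * g d

/-- The truncated pure-sieve main term `∑_{S ⊆ 𝒫₂, |S| ≤ 2r} (−1)^{|S|} ∏_{p∈S} g(p)`. [folklore] -/
noncomputable def bmain (g : ArithmeticFunction ℝ) (z₁ z : ℝ) (r : ℕ) : ℝ :=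
  ∑ S ∈ (midPrimes z₁ z).powerset, (if S.card ≤ 2 * r then (-1 : ℝ) ^ S.card else 0) * ∏ p ∈ S, g p

/-- `g(d₁ ∏S) = g(d₁) ∏_{p∈S} g(p)` on the index set (multiplicativity). [folklore] -/
theorem map_modOf (hg : g.IsMultiplicative) {z₁ z : ℝ} {i : ℕ × Finset ℕ} (hi : i ∈ idx z₁ z) :
    g (modOf i) = g i.1 * ∏ p ∈ i.2, g p := by
  rw [idx, Finset.mem_product, Nat.mem_divisors, Finset.mem_powerset] at hi
  obtain ⟨⟨hd, -⟩, hS⟩ := hi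
  unfold modOf
  rw [hg.map_mul_of_coprime (coprime_of_dvd_of_subset hd hS)]
  congr 1
  refine hg.map_prod (fun p : ℕ => p) i.2 fun p hp q hq hpq => ?_
  exact (Nat.coprime_primes (prime_of_mem_midPrimes (hS hp)) (prime_of_mem_midPrimes (hS hq))).2 hpq

/-- `∑_i w⁺_i g(d(i)) = M⁺ · B`. [folklore] -/
theorem sum_wU_map_eq (hg : g.IsMultiplicative) (z₁ z D₁ : ℝ) (r : ℕ) :
    ∑ i ∈ idx z₁ z, wU D₁ r i * g (modOf i) = mbeta g 1 z₁ D₁ * bmain g z₁ z r := by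
  calc ∑ i ∈ idx z₁ z, wU D₁ r i * g (modOf i)
      = ∑ i ∈ idx z₁ z, wU D₁ r i * (g i.1 * ∏ p ∈ i.2, g p) :=
        Finset.sum_congr rfl fun i hi => by rw [map_modOf hg hi]
    _ = _ := by
        unfold idx mbeta bmain wU
        rw [Finset.sum_product, Finset.sum_mul_sum]
        exact Finset.sum_congr rfl fun d _ => Finset.sum_congr rfl fun S _ => by ring

/-- `∑_i w⁻_i g(d(i)) = M⁻ · B − M⁺ · T`. [folklore] -/
theorem sum_wL_map_eq (hg : g.IsMultiplicative) (z₁ z D₁ : ℝ) (r : ℕ) :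
    ∑ i ∈ idx z₁ z, wL D₁ r i * g (modOf i) =
      mbeta g 0 z₁ D₁ * bmain g z₁ z r - mbeta g 1 z₁ D₁ * tail g z₁ z r := by
  have htail : tail g z₁ z r = ∑ S ∈ (midPrimes z₁ z).powerset,
      (if S.card = 2 * r + 1 then (1 : ℝ) else 0) * ∏ p ∈ S, g p := by
    unfold tail
    rw [Finset.powersetCard_eq_filter, Finset.sum_filter]
    exact Finset.sum_congr rfl fun S _ => by split_ifs <;> simp
  calc ∑ i ∈ idx z₁ z, wL D₁ r i * g (modOf i)
      = ∑ i ∈ idx z₁ z, wL D₁ r i * (g i.1 * ∏ p ∈ i.2, g p) :=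
        Finset.sum_congr rfl fun i hi => by rw [map_modOf hg hi]
    _ = _ := by
        rw [htail]
        unfold idx mbeta bmain wL
        rw [Finset.sum_product, Finset.sum_mul_sum, Finset.sum_mul_sum, ← Finset.sum_sub_distrib]
        refine Finset.sum_congr rfl fun d _ => ?_
        rw [← Finset.sum_sub_distrib]
        exact Finset.sum_congr rfl fun S _ => by ring

/-- The truncated pure-sieve main term in Bonferroni form. [folklore] -/
theorem bmain_eq_bonferroni (z₁ z : ℝ) (r : ℕ) :
    bmain g z₁ z r = ∑ k ∈ Finset.range (2 * r + 1),
      (-1 : ℝ) ^ k * ∑ S ∈ Finset.powersetCard k (midPrimes z₁ z), ∏ p ∈ S, g p := by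
  unfold bmain
  symm
  calc ∑ k ∈ Finset.range (2 * r + 1), (-1 : ℝ) ^ k * ∑ S ∈ Finset.powersetCard k (midPrimes z₁ z), ∏ p ∈ S, g p
      = ∑ k ∈ Finset.range (2 * r + 1), ∑ S ∈ (midPrimes z₁ z).powerset,
          (if S.card = k then (-1 : ℝ) ^ k * ∏ p ∈ S, g p else 0) := by
        refine Finset.sum_congr rfl fun k _ => ?_
        rw [Finset.powersetCard_eq_filter, Finset.sum_filter, Finset.mul_sum]
        exact Finset.sum_congr rfl fun S _ => by split_ifs <;> simp
    _ = ∑ S ∈ (midPrimes z₁ z).powerset, ∑ k ∈ Finset.range (2 * r + 1),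
          (if S.card = k then (-1 : ℝ) ^ k * ∏ p ∈ S, g p else 0) := Finset.sum_comm
    _ = _ := by
        refine Finset.sum_congr rfl fun S _ => ?_
        rw [Finset.sum_ite_eq]
        simp only [Finset.mem_range, Nat.lt_succ_iff]
        split_ifs <;> ring

/-- `V(z) = V₁ · V₂`: the density product over the primes `< z` splits at `z₁ ≤ z`. [folklore] -/
theorem vprod_eq_mul {z₁ z : ℝ} (hz : z₁ ≤ z) :
    BetaSieve.vprod g (primesProdBelow z) = BetaSieve.vprod g (primesProdBelow z₁) * vmid g z₁ z := by
  unfold BetaSieve.vprod vmid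
  rw [primeFactors_primesProdBelow, primeFactors_primesProdBelow, primesBelow_eq_union hz,
    Finset.prod_union (disjoint_primesBelow_midPrimes z₁ z)]

/-- `g(t) ≥ 0` on the squarefree `t` when `g ≥ 0` at primes. [folklore] -/
theorem map_nonneg_of_squarefree (hg : g.IsMultiplicative) (hg0 : ∀ p : ℕ, p.Prime → 0 ≤ g p) {t : ℕ}
    (ht : Squarefree t) : 0 ≤ g t := by
  rw [BetaSieve.map_eq_prod_primeFactors hg ht]
  exact Finset.prod_nonneg fun p hp => hg0 p (Nat.prime_of_mem_primeFactors hp)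

/-- **The main terms of the composite weights** (beta-sieve Fundamental Lemma on `P(z₁)`, Brun's
pure sieve on `[z₁, z)`): for multiplicative `g` of sieve dimension `1` (constant `K`), `2 ≤ z₁ ≤ z`,
`D₁ > 1` with `10 log z₁ ≤ log D₁`, and with `η₁ = 2K^{10} e^{10 − log D₁/log z₁}`,
`V₁ = ∏_{p<z₁}(1−g(p))`, `V₂ = ∏_{z₁≤p<z}(1−g(p))`, `T = e_{2r+1}(g)`:
`|∑_i w^±_i g(d(i)) − V₁V₂| ≤ V₁ (η₁ V₂ + (2 + 2η₁) T)`.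
[cite: Greaves2001, §3.3.4 Thm 1] [cite: CojocaruMurty2005, §6.1 Lemma 6.1.1] -/
theorem abs_main_sub_le (hg : g.IsMultiplicative) (hdim : HasSieveDimension g 1 K) {z₁ D₁ : ℝ} (z : ℝ)
    (hz₁ : 2 ≤ z₁) (hD1 : 1 < D₁) (hzD : 10 * Real.log z₁ ≤ Real.log D₁) (r : ℕ) :
    |∑ i ∈ idx z₁ z, wU D₁ r i * g (modOf i) - BetaSieve.vprod g (primesProdBelow z₁) * vmid g z₁ z| ≤
        BetaSieve.vprod g (primesProdBelow z₁) *
          (2 * K ^ 10 * Real.exp (10 - Real.log D₁ / Real.log z₁) * vmid g z₁ z +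
            (2 + 2 * (2 * K ^ 10 * Real.exp (10 - Real.log D₁ / Real.log z₁))) * tail g z₁ z r) ∧
      |∑ i ∈ idx z₁ z, wL D₁ r i * g (modOf i) - BetaSieve.vprod g (primesProdBelow z₁) * vmid g z₁ z| ≤
        BetaSieve.vprod g (primesProdBelow z₁) *
          (2 * K ^ 10 * Real.exp (10 - Real.log D₁ / Real.log z₁) * vmid g z₁ z +
            (2 + 2 * (2 * K ^ 10 * Real.exp (10 - Real.log D₁ / Real.log z₁))) * tail g z₁ z r) := by
  set P₁ := primesProdBelow z₁ with hP₁
  set V₁ := BetaSieve.vprod g P₁ with hV₁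
  set V₂ := vmid g z₁ z with hV₂
  set T := tail g z₁ z r with hT
  set η₁ : ℝ := 2 * K ^ 10 * Real.exp (10 - Real.log D₁ / Real.log z₁) with hη₁
  have hP₁sq : Squarefree P₁ := squarefree_primesProdBelow z₁
  have hg0p : ∀ p : ℕ, p.Prime → 0 ≤ g p := fun p hp => (hdim.1 p hp).1
  have h01 : ∀ p ∈ P₁.primeFactors, 0 ≤ g p ∧ g p ≤ 1 := fun p hp =>
    ⟨(hdim.1 p (Nat.prime_of_mem_primeFactors hp)).1, (hdim.1 p (Nat.prime_of_mem_primeFactors hp)).2.le⟩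
  have hK1 : 1 ≤ K := hdim.one_le
  have hη₁0 : 0 ≤ η₁ := by positivity
  have hV₁0 : 0 ≤ V₁ := BetaSieve.vprod_nonneg h01
  -- beta-sieve main terms
  have hM : ∀ par : ℕ, |mbeta g par z₁ D₁ - V₁| ≤ η₁ * V₁ := by
    intro par
    have h1 := BetaSieve.abs_mainTerm_sub_le (par := par) (β := 10) (D := D₁) hg hP₁sq
      (fun t ht => map_nonneg_of_squarefree hg hg0p (hP₁sq.squarefree_of_dvd (Nat.dvd_of_mem_divisors ht)))
      (BetaSieve.vlt_nonneg h01)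
    have h2 := BetaSieve.bdry_sum_le (par := par) (β := 10) (D := D₁) hg hdim one_pos hz₁ hD1
      (by norm_num) hzD
    unfold mbeta
    refine h1.trans (h2.trans (le_of_eq ?_))
    rw [hη₁, hV₁, hP₁]
  -- Brun's pure sieve on the middle range
  have h0 : ∀ p ∈ midPrimes z₁ z, 0 ≤ g p := fun p hp => hg0p p (prime_of_mem_midPrimes hp)
  have h1 : ∀ p ∈ midPrimes z₁ z, g p ≤ 1 := fun p hp => (hdim.1 p (prime_of_mem_midPrimes hp)).2.le
  have heven : Even (2 * r) := ⟨r, by ring⟩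
  have hB1 : V₂ ≤ bmain g z₁ z r := by
    rw [bmain_eq_bonferroni, hV₂]
    exact BrunPureSieve.prod_one_sub_le_bonferroniSum _ (fun p => g p) h0 h1 heven
  have hB2 : bmain g z₁ z r ≤ V₂ + T := by
    rw [bmain_eq_bonferroni, hV₂, hT]
    exact BrunPureSieve.bonferroniSum_le_prod_one_sub_add _ (fun p => g p) h0 h1 heven
  have hV₂0 : 0 ≤ V₂ := Finset.prod_nonneg fun p hp => by linarith [h1 p hp]
  have hT0 : 0 ≤ T := Finset.sum_nonneg fun S hS => Finset.prod_nonneg fun p hp =>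
    h0 p ((Finset.mem_powersetCard.1 hS).1 hp)
  have hB0 : 0 ≤ bmain g z₁ z r := hV₂0.trans hB1
  -- the algebra
  have hM1 := hM 1
  have hM0 := hM 0
  have hM1abs : |mbeta g 1 z₁ D₁| ≤ (1 + η₁) * V₁ := by
    have := abs_sub_abs_le_abs_sub (mbeta g 1 z₁ D₁) V₁
    rw [abs_of_nonneg hV₁0] at this
    linarith
  rw [sum_wU_map_eq hg, sum_wL_map_eq hg]
  constructor
  · have hdecomp : mbeta g 1 z₁ D₁ * bmain g z₁ z r - V₁ * V₂ =
        (mbeta g 1 z₁ D₁ - V₁) * bmain g z₁ z r + V₁ * (bmain g z₁ z r - V₂) := by ring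
    rw [hdecomp]
    calc |(mbeta g 1 z₁ D₁ - V₁) * bmain g z₁ z r + V₁ * (bmain g z₁ z r - V₂)|
        ≤ |mbeta g 1 z₁ D₁ - V₁| * bmain g z₁ z r + V₁ * (bmain g z₁ z r - V₂) := by
          refine (abs_add_le _ _).trans (add_le_add ?_ ?_)
          · rw [abs_mul, abs_of_nonneg hB0]
          · rw [abs_of_nonneg (mul_nonneg hV₁0 (by linarith))]
      _ ≤ η₁ * V₁ * (V₂ + T) + V₁ * T := by
          refine add_le_add (mul_le_mul hM1 hB2 hB0 (by positivity)) ?_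
          exact mul_le_mul_of_nonneg_left (by linarith) hV₁0
      _ ≤ V₁ * (η₁ * V₂ + (2 + 2 * η₁) * T) := by nlinarith [mul_nonneg hV₁0 hT0, mul_nonneg hη₁0 (mul_nonneg hV₁0 hT0)]
  · have hdecomp : mbeta g 0 z₁ D₁ * bmain g z₁ z r - mbeta g 1 z₁ D₁ * T - V₁ * V₂ =
        (mbeta g 0 z₁ D₁ - V₁) * bmain g z₁ z r + V₁ * (bmain g z₁ z r - V₂) - mbeta g 1 z₁ D₁ * T := by ring
    rw [hdecomp]
    calc |(mbeta g 0 z₁ D₁ - V₁) * bmain g z₁ z r + V₁ * (bmain g z₁ z r - V₂) - mbeta g 1 z₁ D₁ * T|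
        ≤ |mbeta g 0 z₁ D₁ - V₁| * bmain g z₁ z r + V₁ * (bmain g z₁ z r - V₂) + |mbeta g 1 z₁ D₁| * T := by
          refine (abs_sub _ _).trans (add_le_add ((abs_add_le _ _).trans (add_le_add ?_ ?_)) ?_)
          · rw [abs_mul, abs_of_nonneg hB0]
          · rw [abs_of_nonneg (mul_nonneg hV₁0 (by linarith))]
          · rw [abs_mul, abs_of_nonneg hT0]
      _ ≤ η₁ * V₁ * (V₂ + T) + V₁ * T + (1 + η₁) * V₁ * T := by
          refine add_le_add (add_le_add (mul_le_mul hM0 hB2 hB0 (by positivity)) ?_)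
            (mul_le_mul_of_nonneg_right hM1abs hT0)
          exact mul_le_mul_of_nonneg_left (by linarith) hV₁0
      _ = V₁ * (η₁ * V₂ + (2 + 2 * η₁) * T) := by ring

/-- **The middle range is short**: `V₂⁻¹ ≤ K log z / log z₁`, hence `∑_{z₁≤p<z} g(p) ≤ log(K log z/log z₁)`
and, by Rankin's trick, `T ≤ λ^{−(2r+1)} (K log z / log z₁)^{λ}` for every `λ > 0`. [folklore] -/
theorem vmid_tail_bounds (hdim : HasSieveDimension g 1 K) {z₁ z : ℝ} (hz₁ : 2 ≤ z₁) (hz : z₁ ≤ z) (r : ℕ) :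
    0 < vmid g z₁ z ∧ (vmid g z₁ z)⁻¹ ≤ K * (Real.log z / Real.log z₁) ∧
      ∀ lam : ℝ, 0 < lam → tail g z₁ z r ≤
        (lam ^ (2 * r + 1))⁻¹ * Real.exp (lam * Real.log (K * (Real.log z / Real.log z₁))) := by
  have hlt1 : ∀ p ∈ midPrimes z₁ z, g p < 1 := fun p hp => (hdim.1 p (prime_of_mem_midPrimes hp)).2
  have h0 : ∀ p ∈ midPrimes z₁ z, 0 ≤ g p := fun p hp => (hdim.1 p (prime_of_mem_midPrimes hp)).1
  have hpos : 0 < vmid g z₁ z := Finset.prod_pos fun p hp => by linarith [hlt1 p hp]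
  have hdim2 := hdim.2 z₁ z hz₁ hz
  rw [Real.rpow_one] at hdim2
  have hinv : (vmid g z₁ z)⁻¹ ≤ K * (Real.log z / Real.log z₁) := by
    refine le_trans (le_of_eq ?_) hdim2
    unfold vmid midPrimes
    rw [← Finset.prod_inv_distrib]
  refine ⟨hpos, hinv, fun lam hlam => ?_⟩
  have hKpos : 0 < K * (Real.log z / Real.log z₁) := lt_of_lt_of_le (inv_pos.2 hpos) hinv
  have hsum : ∑ p ∈ midPrimes z₁ z, g p ≤ Real.log (K * (Real.log z / Real.log z₁)) := by
    calc ∑ p ∈ midPrimes z₁ z, g p ≤ ∑ p ∈ midPrimes z₁ z, -Real.log (1 - g p) := by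
          refine Finset.sum_le_sum fun p hp => ?_
          have := Real.log_le_sub_one_of_pos (show 0 < 1 - g p by linarith [hlt1 p hp])
          linarith
      _ = Real.log ((vmid g z₁ z)⁻¹) := by
          rw [Real.log_inv, vmid, Real.log_prod]
          · rw [Finset.sum_neg_distrib]
          · intro p hp; linarith [hlt1 p hp]
      _ ≤ Real.log (K * (Real.log z / Real.log z₁)) := Real.log_le_log (inv_pos.2 hpos) hinv
  calc tail g z₁ z r ≤ (lam ^ (2 * r + 1))⁻¹ * Real.exp (lam * ∑ p ∈ midPrimes z₁ z, g p) :=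
        BrunPureSieve.esymm_le_inv_pow_mul_exp _ (fun p => g p) h0 (2 * r + 1) hlam
    _ ≤ (lam ^ (2 * r + 1))⁻¹ * Real.exp (lam * Real.log (K * (Real.log z / Real.log z₁))) := by
        refine mul_le_mul_of_nonneg_left (Real.exp_le_exp.2 (mul_le_mul_of_nonneg_left hsum hlam.le))
          (by positivity)

end MainTerm

end TwoRangeSieve

end Literature.NumberTheory.Sieve
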